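import Summits.Ventures.YMGap.Thresholds.StarFrontTorusSUN
import Summits.Ventures.YMGap.Thresholds.StarLimitStates
import HarnessLib

/-!
# Venture YMGap — track (c) «DS»: infinite-volume limit states of `SU(N)` lattice Yang–Mills (`d = 4`,
# EVERY `N`) — the one-torus star door for `ℤ⁴` cylinder observables, the weak-limit step, and the
# far-regime covariance bound for a limit state (tools for `StarLimitMassiveSUN.lean`)

HONEST FRAMING: venture file (cell `pub-ymgap`, PLAN R128(b)(ii); ds-3), strong-coupling LATTICE bookkeeping
only, for `SU(N)` lattice Yang–Mills on `ℤ⁴` with the Wilson plaquette weight `exp(−β (N − Re tr U_q))` at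
tree coupling `β`.  INPUT (explicit binders, the four-clause format of ds-1's `SU(N)` files): on a torus (or
on every torus of side `≥ L₁`) a vertex-indexed influence array `Kw ≥ 0` for the star windows of the torus
Wilson specification — supported on boundary links within periodic sup-distance `1` of the centre, (H1)
`IsLinkWindowContraction`, per-star received sums `≤ ρ < 1`.  OUTPUT, kernel-checked GIVEN that input: the
far-regime covariance bounds for bounded cylinder observables of `ℤ⁴` on one torus, along the defining
subsequence of an infinite-volume limit state, and — after DLR smoothing — for bounded MEASURABLE local
observables under the limit state.  Nothing about uniqueness of the DLR state, the continuum, confinement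
or a transfer-matrix gap; no coupling window is asserted here.

WHAT IS NEW HERE is only the port `Fin 2 ↦ Fin N`, `2√2 ↦ 2√N`, `wilsonSmoothLip 2 4 (β_W/2) ↦
wilsonSmoothLip N 4 β`, `StarWindowBound ↦ four clauses` of ds-2's `SU(2)`-typed
`StarLimit.su2Star_torus_far_bound` / `su2Star_limit_far_bound` (`StarLimitTorus.lean`) and
`su2Star_limitState_cov_far` (`StarLimitStates.lean`); the one-torus smoothing bound is ds-1's generic
`StarSUNFront.star_abs_integral_mul_sub_le` (`StarFrontTorusSUN.lean`, port of `su2Star_abs_integral_mul_sub_le`);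
the collar bookkeeping (`card_union_collar_le`, `supNorm_le_of_mem_union_collar`), the Feller property
(`continuous_specAvg_ymSpecification`) and the DLR-smoothing identities (`integral_specAvg`,
`integral_specAvg_mul`) are ds-2's generic tree lemmas, imported.

* `star_torus_far_bound` — one torus of side `L ≥ 2`: `|⟨(Φ₁∘lift)(Φ₂∘lift)⟩ − ⟨Φ₁∘lift⟩⟨Φ₂∘lift⟩| ≤
  4(2√N)² e^{−κ(ρ)(n − D − 4)} (#T₁·J·M₁E)(#T₂·J·M₂E)`, `J = 25`, `E = wilsonSmoothLip N 4 β`;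
* `star_limit_far_bound` — the same bound for a limit state along `L_k + 1 → ∞` and CONTINUOUS cylinder
  observables whose supports are `‖x‖_∞ ≥ D + 4` apart;
* `star_limitState_cov_far` — bounded MEASURABLE local observables `F₁`, `F₂ ∘ θ_x`, `‖x‖_∞ ≥ D + 6`, via
  DLR smoothing under the limit state (a DLR state of the `ℤ⁴` specification).

References: H. Föllmer, LNM 1362 (1988) Ch. I Thm. (2.13); R. L. Dobrushin, S. B. Shlosman (1985);
H.-O. Georgii (2011) Def. 4.11, Thm. 4.17; cell files `LIMIT-STATES.md` (ds-2), `STAR-SUN-SIGNATURES.md` (ds-1).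
-/

noncomputable section

open MeasureTheory ProbabilityTheory Function Finset Filter Topology
open Literature.Probability.LatticeModels
open Literature.Probability.LatticeModels.DobrushinMetric
open Literature.MathematicalPhysics.QuantumLattice (toTorusObservable toTorusObservable_apply IsCylinder
  LGConfig torusLift torusEdge fundamentalRep fundamentalLatticeRep
  configShift_apply infiniteVolumeLimitPoints IsInfiniteVolumeLimitAlong ymSpecification ymGibbsMeasures
  plaquettesTouching plaquetteEdges mem_plaquettesTouching_iff continuous_fundamentalRep
  integral_ymSpecification dependsOn_integral_ymSpecification
  mem_ymGibbsMeasures_of_mem_infiniteVolumeLimitPoints_holds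
  exists_near_of_mem_plaquettesTouching_biUnion)
open Literature.MathematicalPhysics.QuantumFieldTheory
open Literature.MathematicalPhysics.QuantumFieldTheory.Balaban1983to89
open Literature.MathematicalPhysics.QuantumFieldTheory.Balaban1983to89.StrongCouplingTorusWindow
open Summit.Ventures.YMGap.DSWindow
open Summit.Ventures.YMGap.StarLimit

namespace Summit.Ventures.YMGap.StarSUNMassive

variable {N : ℕ}

/-! ### One torus: the star door for cylinder observables of `ℤ⁴` read through the periodic lift -/

section Torus

variable {L : ℕ} [NeZero L]

/-- **Far-regime covariance bound on one torus for two `ℤ⁴` cylinder observables** (`SU(N)`, `d = 4`,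
tree coupling `β`, torus side `L ≥ 2` carrying a star-window influence array with received sums `≤ ρ < 1`):
if `Φ₁, Φ₂` are bounded measurable cylinder observables of `ℤ⁴` with supports `T₁, T₂` whose projected base
points are `≥ n − D` apart in the periodic sup-distance, `n ≥ D + 4`, then under the torus Wilson measure
`|⟨(Φ₁∘lift)(Φ₂∘lift)⟩ − ⟨Φ₁∘lift⟩⟨Φ₂∘lift⟩| ≤ 4(2√N)² e^{−κ(ρ)(n − D − 4)} (#T₁·J·M₁E)(#T₂·J·M₂E)`,
`J = 1 + 8·3`, `E = wilsonSmoothLip N 4 β` (ds-1's `StarSUNFront.star_abs_integral_mul_sub_le` with the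
`StarFront` geometry).  Port of `StarLimit.su2Star_torus_far_bound`. [folklore] -/
theorem star_torus_far_bound (hL : 1 < L) (hN : 1 ≤ N) (β : ℝ) {ρ : ℝ} (hρ0 : 0 ≤ ρ) (hρ1 : ρ < 1)
    {Kw : Site 4 L → Edge 4 L → Edge 4 L → ℝ} (hK : ∀ s y x, 0 ≤ Kw s y x)
    (hKloc : ∀ s y x, Kw s y x ≠ 0 → ∀ w ∈ linkEnds y, torusNorm (s - w) ≤ 1)
    (hH1 : IsLinkWindowContraction (d := 4) (L := L) (wilsonPlaqWeight N β) suFrobDist starWin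
      fun c => Kw c.1)
    (hsum : ∀ (s : Site 4 L) (x : Edge 4 L), x ∈ vertexStar s → ∑ y, Kw s y x ≤ ρ)
    {Φ₁ Φ₂ : LGConfig 4 (Matrix.specialUnitaryGroup (Fin N) ℂ) → ℝ} (h₁m : Measurable Φ₁)
    (h₂m : Measurable Φ₂) {T₁ T₂ : Finset (Literature.MathematicalPhysics.QuantumLattice.ZdEdge 4)}
    (h₁T : IsCylinder Φ₁ T₁) (h₂T : IsCylinder Φ₂ T₂) {M₁ M₂ : ℝ} (hM₁ : ∀ U, |Φ₁ U| ≤ M₁)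
    (hM₂ : ∀ U, |Φ₂ U| ≤ M₂) {n D : ℕ} (hfar : D + 4 ≤ n)
    (hgeom : ∀ a ∈ T₁, ∀ b ∈ T₂, n ≤ torusNorm ((torusEdge L a).1 - (torusEdge L b).1) + D) :
    |(∫ V, toTorusObservable L Φ₁ V * toTorusObservable L Φ₂ V
          ∂(wilsonMeasure (d := 4) (L := L) (fundamentalRep (Fin N)) β)) -
        (∫ V, toTorusObservable L Φ₁ V ∂(wilsonMeasure (d := 4) (L := L) (fundamentalRep (Fin N)) β)) *
          ∫ V, toTorusObservable L Φ₂ V ∂(wilsonMeasure (d := 4) (L := L) (fundamentalRep (Fin N)) β)| ≤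
      4 * (2 * Real.sqrt N) ^ 2 * Real.exp (-(starRate ρ * ((n - (D + 4) : ℕ) : ℝ))) *
        ((T₁.card : ℝ) * (((1 + 4 * (2 * (4 - 1)) : ℕ) : ℝ)) * (M₁ * wilsonSmoothLip N 4 β)) *
        ((T₂.card : ℝ) * (((1 + 4 * (2 * (4 - 1)) : ℕ) : ℝ)) * (M₂ * wilsonSmoothLip N 4 β)) := by
  classical
  set μ := wilsonMeasure (d := 4) (L := L) (fundamentalRep (Fin N)) β with hμdef
  set J : ℝ := ((1 + 4 * (2 * (4 - 1)) : ℕ) : ℝ) with hJdef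
  have hJ0 : 0 ≤ J := by rw [hJdef]; exact Nat.cast_nonneg _
  set E : ℝ := wilsonSmoothLip N 4 β with hEdef
  have hE0 : 0 ≤ E := wilsonSmoothLip_nonneg hN 4 β
  have hM₁0 : 0 ≤ M₁ := (abs_nonneg _).trans (hM₁ fun _ => 1)
  have hM₂0 : 0 ≤ M₂ := (abs_nonneg _).trans (hM₂ fun _ => 1)
  set f : GaugeConfig 4 L (Matrix.specialUnitaryGroup (Fin N) ℂ) → ℝ := toTorusObservable L Φ₁
  set g : GaugeConfig 4 L (Matrix.specialUnitaryGroup (Fin N) ℂ) → ℝ := toTorusObservable L Φ₂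
  have hfm : Measurable f := h₁m.comp (measurable_torusLift L)
  have hgm : Measurable g := h₂m.comp (measurable_torusLift L)
  set Δf : Finset (Edge 4 L) := T₁.image (torusEdge L) with hΔf
  set Δg : Finset (Edge 4 L) := T₂.image (torusEdge L) with hΔg
  have hfdep : DependsOn f (↑Δf : Set (Edge 4 L)) := dependsOn_toTorusObservable L h₁T
  have hgdep : DependsOn g (↑Δg : Set (Edge 4 L)) := dependsOn_toTorusObservable L h₂T
  have hMf : ∀ σ, |f σ| ≤ M₁ := fun σ => hM₁ _
  have hMg : ∀ σ, |g σ| ≤ M₂ := fun σ => hM₂ _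
  -- the plaquette closure of `Δf` misses `Δg`
  have hsep : ∀ y ∈ plaqClosure Δf, y ∉ Δg := by
    intro y hy hyg
    obtain ⟨y₀, hy₀, hyy₀⟩ := exists_near_of_mem_plaqClosure hy
    obtain ⟨a, ha, rfl⟩ := Finset.mem_image.1 hy₀
    obtain ⟨b, hb, rfl⟩ := Finset.mem_image.1 hyg
    have h1 : torusNorm ((torusEdge L a).1 - (torusEdge L b).1) ≤ 1 := by
      rw [← torusNorm_neg, neg_sub]; exact hyy₀
    have h2 := hgeom a ha b hb
    omega
  -- the endpoint distance between the two plaquette closures is `≥ n − D − 4`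
  have hL₀ : ∀ y ∈ plaqClosure Δf, ∀ z ∈ plaqClosure Δg, ∀ a ∈ linkEnds y, ∀ w ∈ linkEnds z,
      n - (D + 4) ≤ torusNorm (a - w) := by
    intro y hy z hz a ha w hw
    obtain ⟨y₀, hy₀, hyy₀⟩ := exists_near_of_mem_plaqClosure hy
    obtain ⟨a₀, ha₀, rfl⟩ := Finset.mem_image.1 hy₀
    obtain ⟨z₀, hz₀, hzz₀⟩ := exists_near_of_mem_plaqClosure hz
    obtain ⟨b₀, hb₀, rfl⟩ := Finset.mem_image.1 hz₀
    have h2 := hgeom a₀ ha₀ b₀ hb₀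
    have htri : torusNorm ((torusEdge L a₀).1 - (torusEdge L b₀).1) ≤
        1 + 1 + torusNorm (a - w) + 1 + 1 := by
      calc torusNorm ((torusEdge L a₀).1 - (torusEdge L b₀).1)
          ≤ torusNorm ((torusEdge L a₀).1 - y.1) + torusNorm (y.1 - (torusEdge L b₀).1) :=
            torusNorm_sub_le _ _ _
        _ ≤ torusNorm ((torusEdge L a₀).1 - y.1) + (torusNorm (y.1 - a) +
            torusNorm (a - (torusEdge L b₀).1)) :=
            Nat.add_le_add_left (torusNorm_sub_le _ _ _) _
        _ ≤ torusNorm ((torusEdge L a₀).1 - y.1) + (torusNorm (y.1 - a) +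
            (torusNorm (a - w) + torusNorm (w - (torusEdge L b₀).1))) :=
            Nat.add_le_add_left (Nat.add_le_add_left (torusNorm_sub_le _ _ _) _) _
        _ ≤ torusNorm ((torusEdge L a₀).1 - y.1) + (torusNorm (y.1 - a) +
            (torusNorm (a - w) + (torusNorm (w - z.1) + torusNorm (z.1 - (torusEdge L b₀).1)))) :=
            Nat.add_le_add_left (Nat.add_le_add_left (Nat.add_le_add_left
              (torusNorm_sub_le _ _ _) _) _) _
        _ ≤ 1 + (1 + (torusNorm (a - w) + (1 + 1))) := by
            refine Nat.add_le_add ?_ (Nat.add_le_add (torusNorm_fst_sub_linkEnds_le_one y ha)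
              (Nat.add_le_add_left (Nat.add_le_add ?_ hzz₀) _))
            · rw [← torusNorm_neg, neg_sub]; exact hyy₀
            · rw [← torusNorm_neg, neg_sub]; exact torusNorm_fst_sub_linkEnds_le_one z hw
        _ = 1 + 1 + torusNorm (a - w) + 1 + 1 := by ring
    omega
  have key := StarSUNFront.star_abs_integral_mul_sub_le hL hN β hρ0 hρ1 hK hKloc hH1 hsum hfm hfdep hMf
    hgm hgdep hMg hsep (n - (D + 4)) hL₀
  rw [← hμdef] at key
  refine key.trans ?_
  have hcardf : ((plaqClosure Δf).card : ℝ) ≤ T₁.card * J := by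
    have h1 : ((plaqClosure Δf).card : ℝ) ≤ Δf.card * J := by
      rw [hJdef]; exact_mod_cast card_plaqClosure_le Δf
    have h2 : (Δf.card : ℝ) ≤ T₁.card := by exact_mod_cast Finset.card_image_le
    exact h1.trans (mul_le_mul_of_nonneg_right h2 hJ0)
  have hcardg : ((plaqClosure Δg).card : ℝ) ≤ T₂.card * J := by
    have h1 : ((plaqClosure Δg).card : ℝ) ≤ Δg.card * J := by
      rw [hJdef]; exact_mod_cast card_plaqClosure_le Δg
    have h2 : (Δg.card : ℝ) ≤ T₂.card := by exact_mod_cast Finset.card_image_le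
    exact h1.trans (mul_le_mul_of_nonneg_right h2 hJ0)
  have hME₁ : 0 ≤ M₁ * E := mul_nonneg hM₁0 hE0
  have hME₂ : 0 ≤ M₂ * E := mul_nonneg hM₂0 hE0
  have hY : 0 ≤ (T₂.card : ℝ) * J * (M₂ * E) := by positivity
  have hX : 0 ≤ 4 * (2 * Real.sqrt N) ^ 2 * Real.exp (-(starRate ρ * ((n - (D + 4) : ℕ) : ℝ))) := by
    positivity
  gcongr

end Torus

/-! ### The door for infinite-volume limit states -/

section Limit

/-- **Weak-limit step** (`SU(N)`): a covariance bound valid on every large torus of the defining subsequence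
passes to the infinite-volume limit state, for bounded CONTINUOUS cylinder observables `Φ₁, Φ₂` of `ℤ⁴`:
if every torus of side `L ≥ L₁` carries a star-window influence array with received sums `≤ ρ < 1`, `μ` is
the limit of the torus Wilson states along `L_k + 1`, and `‖a − (b + x)‖_∞ ≤ D` for all base points `a` of
`T₁`, `b` of `T₂` with `‖x‖_∞ ≥ D + 4`, then
`|μ(Φ₁Φ₂) − μ(Φ₁)μ(Φ₂)| ≤ 4(2√N)² e^{−κ(ρ)(‖x‖_∞ − D − 4)} (#T₁·J·M₁E)(#T₂·J·M₂E)`.  Port of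
`StarLimit.su2Star_limit_far_bound`. [folklore] -/
theorem star_limit_far_bound (hN : 1 ≤ N) (β : ℝ) {ρ : ℝ} (hρ0 : 0 ≤ ρ) (hρ1 : ρ < 1) (L₁ : ℕ)
    (hW : ∀ (L : ℕ) [NeZero L], L₁ ≤ L → ∃ Kw : Site 4 L → Edge 4 L → Edge 4 L → ℝ,
      (∀ s y e, 0 ≤ Kw s y e) ∧ (∀ s y e, Kw s y e ≠ 0 → ∀ w ∈ linkEnds y, torusNorm (s - w) ≤ 1) ∧
      IsLinkWindowContraction (d := 4) (L := L) (wilsonPlaqWeight N β) suFrobDist starWin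
        (fun c => Kw c.1) ∧
      ∀ (s : Site 4 L) (e : Edge 4 L), e ∈ vertexStar s → ∑ y, Kw s y e ≤ ρ)
    {μ : Measure (LGConfig 4 (Matrix.specialUnitaryGroup (Fin N) ℂ))} {Lseq : ℕ → ℕ}
    (hLmono : StrictMono Lseq)
    (hμL : IsInfiniteVolumeLimitAlong (d := 4) (fundamentalRep (Fin N)) β Lseq μ)
    {Φ₁ Φ₂ : LGConfig 4 (Matrix.specialUnitaryGroup (Fin N) ℂ) → ℝ} (h₁c : Continuous Φ₁)
    (h₂c : Continuous Φ₂) (h₁m : Measurable Φ₁) (h₂m : Measurable Φ₂)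
    {T₁ T₂ : Finset (Literature.MathematicalPhysics.QuantumLattice.ZdEdge 4)} (h₁T : IsCylinder Φ₁ T₁)
    (h₂T : IsCylinder Φ₂ T₂) {M₁ M₂ : ℝ} (hM₁ : ∀ U, |Φ₁ U| ≤ M₁) (hM₂ : ∀ U, |Φ₂ U| ≤ M₂)
    (x : Literature.Probability.LatticeModels.Site 4) {D : ℕ}
    (hxD : ∀ a ∈ T₁, ∀ b ∈ T₂,
      Literature.Probability.LatticeModels.Site.supNorm (a.1 - (b.1 + x)) ≤ D)
    (hfar : D + 4 ≤ Literature.Probability.LatticeModels.Site.supNorm x) :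
    |(∫ U, Φ₁ U * Φ₂ U ∂μ) - (∫ U, Φ₁ U ∂μ) * ∫ U, Φ₂ U ∂μ| ≤
      4 * (2 * Real.sqrt N) ^ 2 *
        Real.exp (-(starRate ρ *
          ((Literature.Probability.LatticeModels.Site.supNorm x - (D + 4) : ℕ) : ℝ))) *
        ((T₁.card : ℝ) * (((1 + 4 * (2 * (4 - 1)) : ℕ) : ℝ)) * (M₁ * wilsonSmoothLip N 4 β)) *
        ((T₂.card : ℝ) * (((1 + 4 * (2 * (4 - 1)) : ℕ) : ℝ)) * (M₂ * wilsonSmoothLip N 4 β)) := by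
  obtain ⟨hprob, hlim⟩ := hμL
  set nx : ℕ := Literature.Probability.LatticeModels.Site.supNorm x with hnx
  -- the three torus expectations converge
  have hP : IsCylinder (fun U => Φ₁ U * Φ₂ U) (T₁ ∪ T₂) := IsCylinder.mul h₁T h₂T
  have t1 := hlim (fun U => Φ₁ U * Φ₂ U) _ hP (h₁c.mul h₂c)
    ⟨M₁ * M₂, fun U => abs_mul_le_of_abs_le hM₁ hM₂ U⟩
  have t2 := hlim Φ₁ T₁ h₁T h₁c ⟨M₁, hM₁⟩
  have t3 := hlim Φ₂ T₂ h₂T h₂c ⟨M₂, hM₂⟩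
  have t := (t1.sub (t2.mul t3)).abs
  refine le_of_tendsto t ?_
  -- the bound on every large torus of the subsequence
  filter_upwards [eventually_ge_atTop (max L₁ (2 * nx))] with k hk
  have hkL : max L₁ (2 * nx) ≤ Lseq k := hk.trans hLmono.le_apply
  have hL1 : 1 < Lseq k + 1 := by omega
  have hxL : 2 * Literature.Probability.LatticeModels.Site.supNorm x < Lseq k + 1 := by
    rw [← hnx]; omega
  obtain ⟨Kw, hK, hKloc, hH1, hsum⟩ := hW (Lseq k + 1) (by omega)
  have hgeom : ∀ a ∈ T₁, ∀ b ∈ T₂,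
      nx ≤ torusNorm ((torusEdge (Lseq k + 1) a).1 - (torusEdge (Lseq k + 1) b).1) + D := by
    intro a ha b hb
    have hs := supNorm_le_torusNorm_add (L := Lseq k + 1) (a := a.1) (b := b.1 + x) hxL
    rw [add_sub_cancel_right] at hs
    exact hs.trans (Nat.add_le_add_left (hxD a ha b hb) _)
  have h := star_torus_far_bound hL1 hN β hρ0 hρ1 hK hKloc hH1 hsum h₁m h₂m h₁T h₂T hM₁ hM₂ hfar hgeom
  unfold wilsonExpectation
  exact h

/-- **Far-regime covariance bound for a limit state, bounded MEASURABLE local observables** (`SU(N)`,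
`d = 4`): DLR smoothing under the limit state (a DLR state of the `ℤ⁴` specification) followed by the
weak-limit step `star_limit_far_bound` for the (continuous) smoothed observables.  Here `D` bounds
`‖a₀ − b₀‖_∞` over the supports `S₁ × S₂` and `‖x‖_∞ ≥ D + 6`.  Port of `StarLimit.su2Star_limitState_cov_far`.
[folklore] -/
theorem star_limitState_cov_far (hN : 1 ≤ N) (β : ℝ) {ρ : ℝ} (hρ0 : 0 ≤ ρ) (hρ1 : ρ < 1) (L₁ : ℕ)
    (hW : ∀ (L : ℕ) [NeZero L], L₁ ≤ L → ∃ Kw : Site 4 L → Edge 4 L → Edge 4 L → ℝ,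
      (∀ s y e, 0 ≤ Kw s y e) ∧ (∀ s y e, Kw s y e ≠ 0 → ∀ w ∈ linkEnds y, torusNorm (s - w) ≤ 1) ∧
      IsLinkWindowContraction (d := 4) (L := L) (wilsonPlaqWeight N β) suFrobDist starWin
        (fun c => Kw c.1) ∧
      ∀ (s : Site 4 L) (e : Edge 4 L), e ∈ vertexStar s → ∑ y, Kw s y e ≤ ρ)
    {μ : Measure (LGConfig 4 (Matrix.specialUnitaryGroup (Fin N) ℂ))} {Lseq : ℕ → ℕ}
    (hLmono : StrictMono Lseq)
    (hμL : IsInfiniteVolumeLimitAlong (d := 4) (fundamentalRep (Fin N)) β Lseq μ)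
    {F₁ F₂ : LGConfig 4 (Matrix.specialUnitaryGroup (Fin N) ℂ) → ℝ} (h₁m : Measurable F₁)
    (h₂m : Measurable F₂) {S₁ S₂ : Finset (Literature.MathematicalPhysics.QuantumLattice.ZdEdge 4)}
    (hS₁ : IsCylinder F₁ S₁) (hS₂ : IsCylinder F₂ S₂) {M₁ M₂ : ℝ} (hM₁ : ∀ U, |F₁ U| ≤ M₁)
    (hM₂ : ∀ U, |F₂ U| ≤ M₂) (x : Literature.Probability.LatticeModels.Site 4) {D : ℕ}
    (hD : ∀ a₀ ∈ S₁, ∀ b₀ ∈ S₂,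
      Literature.Probability.LatticeModels.Site.supNorm (a₀.1 - b₀.1) ≤ D)
    (hfar : D + 6 ≤ Literature.Probability.LatticeModels.Site.supNorm x) :
    |(∫ U, F₁ U * (F₂ ∘ Literature.MathematicalPhysics.QuantumLattice.configShift x) U ∂μ) -
        (∫ U, F₁ U ∂μ) *
          ∫ U, (F₂ ∘ Literature.MathematicalPhysics.QuantumLattice.configShift x) U ∂μ| ≤
      4 * (2 * Real.sqrt N) ^ 2 *
        Real.exp (-(starRate ρ *
          ((Literature.Probability.LatticeModels.Site.supNorm x - (D + 2 + 4) : ℕ) : ℝ))) *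
        (((((1 + 4 * (2 * (4 - 1))) * S₁.card : ℕ) : ℝ)) * (((1 + 4 * (2 * (4 - 1)) : ℕ) : ℝ)) *
          (M₁ * wilsonSmoothLip N 4 β)) *
        (((((1 + 4 * (2 * (4 - 1))) * S₂.card : ℕ) : ℝ)) * (((1 + 4 * (2 * (4 - 1)) : ℕ) : ℝ)) *
          (M₂ * wilsonSmoothLip N 4 β)) := by
  classical
  haveI : SecondCountableTopology (Matrix (Fin N) (Fin N) ℂ) :=
    inferInstanceAs (SecondCountableTopology (Fin N → Fin N → ℂ))
  haveI : SecondCountableTopology (Matrix.specialUnitaryGroup (Fin N) ℂ) :=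
    Topology.IsEmbedding.subtypeVal.secondCountableTopology
  haveI := hμL.1
  have hM₁0 : 0 ≤ M₁ := (abs_nonneg _).trans (hM₁ fun _ => 1)
  have hM₂0 : 0 ≤ M₂ := (abs_nonneg _).trans (hM₂ fun _ => 1)
  have hE0 : 0 ≤ wilsonSmoothLip N 4 β := wilsonSmoothLip_nonneg hN 4 β
  have hJ0 : (0 : ℝ) ≤ (((1 + 4 * (2 * (4 - 1)) : ℕ) : ℝ)) := Nat.cast_nonneg _
  have hρc := continuous_fundamentalRep (Fin N)
  set γ := ymSpecification (d := 4) (fundamentalRep (Fin N)) β with hγdef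
  have hγ : IsSpecification γ := isSpecification_ymSpecification_of_t2Space _ hρc _
  have hGibbs : IsGibbsMeasure γ μ :=
    mem_ymGibbsMeasures_of_mem_infiniteVolumeLimitPoints_holds (d := 4) (fundamentalRep (Fin N))
      hρc ⟨Lseq, hLmono, hμL⟩
  set Gx : LGConfig 4 (Matrix.specialUnitaryGroup (Fin N) ℂ) → ℝ :=
    F₂ ∘ Literature.MathematicalPhysics.QuantumLattice.configShift x with hGxdef
  obtain ⟨S₂x, hS₂x⟩ : ∃ S : Finset (Literature.MathematicalPhysics.QuantumLattice.ZdEdge 4),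
      S = S₂.image fun e => (e.1 - x, e.2) := ⟨_, rfl⟩
  have hGxS : IsCylinder Gx S₂x := by
    rw [hS₂x]; exact IsCylinder.comp_configShift hS₂ x
  have hGxm : Measurable Gx :=
    h₂m.comp (Literature.MathematicalPhysics.QuantumLattice.configShift x).measurable
  have hGxM : ∀ U, |Gx U| ≤ M₂ := fun U => hM₂ _
  -- the smoothed observables: measurable, bounded, cylinders on support ∪ collar, CONTINUOUS
  set f₁ : LGConfig 4 (Matrix.specialUnitaryGroup (Fin N) ℂ) → ℝ := specAvg γ S₁ F₁ with hf₁def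
  set g₂ : LGConfig 4 (Matrix.specialUnitaryGroup (Fin N) ℂ) → ℝ := specAvg γ S₂x Gx with hg₂def
  have hf₁m : Measurable f₁ := measurable_specAvg hγ S₁ h₁m
  have hg₂m : Measurable g₂ := measurable_specAvg hγ S₂x hGxm
  have hf₁M : ∀ U, |f₁ U| ≤ M₁ := abs_specAvg_le hγ S₁ hM₁
  have hg₂M : ∀ U, |g₂ U| ≤ M₂ := abs_specAvg_le hγ S₂x hGxM
  obtain ⟨T₁, hT₁⟩ : ∃ T : Finset (Literature.MathematicalPhysics.QuantumLattice.ZdEdge 4),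
      T = S₁ ∪ (plaquettesTouching S₁).biUnion plaquetteEdges := ⟨_, rfl⟩
  obtain ⟨T₂, hT₂⟩ : ∃ T : Finset (Literature.MathematicalPhysics.QuantumLattice.ZdEdge 4),
      T = S₂x ∪ (plaquettesTouching S₂x).biUnion plaquetteEdges := ⟨_, rfl⟩
  have hf₁T : IsCylinder f₁ T₁ := by
    rw [hT₁]
    exact dependsOn_integral_ymSpecification (fundamentalRep (Fin N)) hρc β S₁ h₁m hS₁
  have hg₂T : IsCylinder g₂ T₂ := by
    rw [hT₂]
    exact dependsOn_integral_ymSpecification (fundamentalRep (Fin N)) hρc β S₂x hGxm hGxS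
  have hf₁c : Continuous f₁ :=
    continuous_specAvg_ymSpecification (fundamentalRep (Fin N)) hρc β S₁ h₁m hS₁ hM₁
  have hg₂c : Continuous g₂ :=
    continuous_specAvg_ymSpecification (fundamentalRep (Fin N)) hρc β S₂x hGxm hGxS hGxM
  -- geometry: base points of `T₁` and `T₂ + x` are within `D + 2`; hence `T₁ ∩ T₂ = ∅`
  have hxD : ∀ a ∈ T₁, ∀ b ∈ T₂,
      Literature.Probability.LatticeModels.Site.supNorm (a.1 - (b.1 + x)) ≤ D + 2 := by
    intro a ha b hb
    rw [hT₁] at ha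
    rw [hT₂, hS₂x] at hb
    exact supNorm_le_of_mem_union_collar hD x ha hb
  have hdisj : ∀ a ∈ T₁, ∀ b ∈ T₂, a ≠ b := by
    intro a ha b hb hab
    subst hab
    have h := hxD a ha a hb
    have hax : a.1 - (a.1 + x) = -x := sub_add_cancel_left a.1 x
    have hneg : Literature.Probability.LatticeModels.Site.supNorm (-x) =
        Literature.Probability.LatticeModels.Site.supNorm x := by
      simp only [Literature.Probability.LatticeModels.Site.supNorm, Pi.neg_apply, Int.natAbs_neg]
    rw [hax, hneg] at h
    omega
  -- DLR smoothing: the three integrals are unchanged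
  have hI₁ : ∫ U, F₁ U * Gx U ∂μ = ∫ U, f₁ U * g₂ U ∂μ := by
    have hS₁T₁ : ∀ e ∈ S₁, e ∈ T₁ := fun e he => by rw [hT₁]; exact Finset.mem_union_left _ he
    have hS₂T₂ : ∀ e ∈ S₂x, e ∈ T₂ := fun e he => by rw [hT₂]; exact Finset.mem_union_left _ he
    have ha : ∫ U, f₁ U * Gx U ∂μ = ∫ U, F₁ U * Gx U ∂μ :=
      integral_specAvg_mul hγ hGibbs S₁ h₁m hM₁ hGxm hGxM hGxS fun e he heS =>
        hdisj e (hS₁T₁ e he) e (hS₂T₂ e (Finset.mem_coe.1 heS)) rfl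
    have hb : ∫ U, g₂ U * f₁ U ∂μ = ∫ U, Gx U * f₁ U ∂μ :=
      integral_specAvg_mul hγ hGibbs S₂x hGxm hGxM hf₁m hf₁M hf₁T fun e he heT =>
        hdisj e (Finset.mem_coe.1 heT) e (hS₂T₂ e he) rfl
    calc ∫ U, F₁ U * Gx U ∂μ = ∫ U, f₁ U * Gx U ∂μ := ha.symm
      _ = ∫ U, Gx U * f₁ U ∂μ := integral_congr_ae (ae_of_all _ fun U => mul_comm _ _)
      _ = ∫ U, g₂ U * f₁ U ∂μ := hb.symm
      _ = ∫ U, f₁ U * g₂ U ∂μ := integral_congr_ae (ae_of_all _ fun U => mul_comm _ _)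
  have hI₂ : ∫ U, F₁ U ∂μ = ∫ U, f₁ U ∂μ := (integral_specAvg hγ hGibbs S₁ h₁m hM₁).symm
  have hI₃ : ∫ U, Gx U ∂μ = ∫ U, g₂ U ∂μ := (integral_specAvg hγ hGibbs S₂x hGxm hGxM).symm
  rw [hI₁, hI₂, hI₃]
  have hfar' : D + 2 + 4 ≤ Literature.Probability.LatticeModels.Site.supNorm x := by omega
  have hle := star_limit_far_bound hN β hρ0 hρ1 L₁ hW hLmono hμL hf₁c hg₂c hf₁m hg₂m hf₁T hg₂T
    hf₁M hg₂M x hxD hfar'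
  refine hle.trans ?_
  have hcard₁ : (T₁.card : ℝ) ≤ ((((1 + 4 * (2 * (4 - 1))) * S₁.card : ℕ) : ℝ)) := by
    have h1 : T₁.card ≤ (1 + 4 * (2 * (4 - 1))) * S₁.card := by
      rw [hT₁]; exact card_union_collar_le S₁
    exact_mod_cast h1
  have hcard₂ : (T₂.card : ℝ) ≤ ((((1 + 4 * (2 * (4 - 1))) * S₂.card : ℕ) : ℝ)) := by
    have h1 : T₂.card ≤ (1 + 4 * (2 * (4 - 1))) * S₂x.card := by
      rw [hT₂]; exact card_union_collar_le S₂x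
    have h2 : S₂x.card ≤ S₂.card := by rw [hS₂x]; exact Finset.card_image_le
    exact_mod_cast h1.trans (Nat.mul_le_mul_left _ h2)
  have hME₁ : 0 ≤ M₁ * wilsonSmoothLip N 4 β := mul_nonneg hM₁0 hE0
  have hME₂ : 0 ≤ M₂ * wilsonSmoothLip N 4 β := mul_nonneg hM₂0 hE0
  have hA₁ : (T₁.card : ℝ) * (((1 + 4 * (2 * (4 - 1)) : ℕ) : ℝ)) * (M₁ * wilsonSmoothLip N 4 β) ≤
      ((((1 + 4 * (2 * (4 - 1))) * S₁.card : ℕ) : ℝ)) * (((1 + 4 * (2 * (4 - 1)) : ℕ) : ℝ)) *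
        (M₁ * wilsonSmoothLip N 4 β) :=
    mul_le_mul_of_nonneg_right (mul_le_mul_of_nonneg_right hcard₁ hJ0) hME₁
  have hA₂ : (T₂.card : ℝ) * (((1 + 4 * (2 * (4 - 1)) : ℕ) : ℝ)) * (M₂ * wilsonSmoothLip N 4 β) ≤
      ((((1 + 4 * (2 * (4 - 1))) * S₂.card : ℕ) : ℝ)) * (((1 + 4 * (2 * (4 - 1)) : ℕ) : ℝ)) *
        (M₂ * wilsonSmoothLip N 4 β) :=
    mul_le_mul_of_nonneg_right (mul_le_mul_of_nonneg_right hcard₂ hJ0) hME₂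
  have hA₂0 : 0 ≤ (T₂.card : ℝ) * (((1 + 4 * (2 * (4 - 1)) : ℕ) : ℝ)) *
      (M₂ * wilsonSmoothLip N 4 β) :=
    mul_nonneg (mul_nonneg (Nat.cast_nonneg _) hJ0) hME₂
  have hB₁0 : 0 ≤ ((((1 + 4 * (2 * (4 - 1))) * S₁.card : ℕ) : ℝ)) *
      (((1 + 4 * (2 * (4 - 1)) : ℕ) : ℝ)) * (M₁ * wilsonSmoothLip N 4 β) :=
    mul_nonneg (mul_nonneg (Nat.cast_nonneg _) hJ0) hME₁
  have hP0 : 0 ≤ 4 * (2 * Real.sqrt N) ^ 2 * Real.exp (-(starRate ρ *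
      ((Literature.Probability.LatticeModels.Site.supNorm x - (D + 2 + 4) : ℕ) : ℝ))) := by
    positivity
  exact mul_le_mul (mul_le_mul_of_nonneg_left hA₁ hP0) hA₂ hA₂0 (mul_nonneg hP0 hB₁0)

end Limit

end Summit.Ventures.YMGap.StarSUNMassive

end
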